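import Summits.ValiantsHypothesis.ValiantsHypothesis.Theorems.NcCentralWidth
import Literature.Computability.AlgebraicComplexity.HWY10SumOfSquares
import HarnessLib

/-!
# Degree four: central width bounds bilinear complexity (Hrubeš–Wigderson–Yehudayoff §2, §B)

Workshop file for the node `CommutativityDial` (decomp-valiant lens 6; road K5a′, stage 2 of 3 towards
the named fact `HWY10_thm_1_7`), on top of the span-form structure theorem of `NcCentralWidth`.
§1 the coefficient functional `coeff w` (words are the basis) and the SPLITTING of a coefficient of a
product of homogeneous elements along the cut (`coeff_mul_degPart`; at degree four `coeff_hghb₀/₁/₂`).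
§2 HWY's family `idPoly k = ID_k = Σ_{i,j} x_i y_j x_i y_j` (§1.3): commutative image `SOS_k` (D1), the
ordered `XYXY`-coefficient functional `quadXY`, `quadXY ID_k = SOS_k`. §3 PROPOSITION B.1(i)/2.1, span
form (D2): under `quadXY` a degree-four central product `h·g·h̄` with quadratic body `g` is ONE product of
two bilinear forms whose first factor is one of the TWO forms `g[X,Y]`, `g[Y,X]` (end placements share
`g[X,Y]`), so the central span over `t` quadratic bodies has bilinear complexity `≤ 2t`. §4 THEOREM 1.6
at degree four, constant `2` (D3): `≤ s` gates for `ID_k` give `B_F(SOS_k) ≤ 2s` over every commutative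
ring; the CONDITIONAL RUNG (D4): `SOSBilinearSuperlinear F` ⟹ `ID_k` needs `≥ (c/2)·k^{1+ε}` gates.
HONEST FRAMING: theorems in print (HWY, J. AMS 24 (2011): Prop. 2.1, Prop. B.1, Thm 1.6), new in the
kernel over the tree's straight-line model, sharper only in bookkeeping; D4 transfers an OPEN numeric
hypothesis and is no lower bound; the permanent (Thm 1.7 via Lemma 2.3 = stage 3) and `VP ≠ VNP` are
untouched.
-/

noncomputable section

namespace Summit.ValiantsHypothesis.ValiantsHypothesis.Theorems.NcSOSDegreeFour

open Literature.Computability.AlgebraicComplexity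
open Literature.Computability.AlgebraicComplexity.ArithCircuit
open Summit.ValiantsHypothesis.ValiantsHypothesis.Theorems.NcAutomatonIntersection
open Summit.ValiantsHypothesis.ValiantsHypothesis.Theorems.NcCentralWidth
open MvPolynomial (X)

universe u v

/-! ## §1 Coefficients of words, components of words, coefficients of homogeneous products -/
section Coeff
variable {R : Type u} [CommSemiring R] {σ : Type v}

/-- The COEFFICIENT functional of the word `w`, `f ↦ [w]f`, read through `R⟨σ⟩ ≃ R[FreeMonoid σ]`
(linear in `f`). [cite: HrubesWigdersonYehudayoff2010, §2] -/
def coeff (w : List σ) : FreeAlgebra R σ →ₗ[R] R :=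
  Finsupp.lapply (FreeMonoid.ofList w) ∘ₗ (MonoidAlgebra.coeffLinearEquiv R).toLinearMap ∘ₗ
    (FreeAlgebra.equivMonoidAlgebraFreeMonoid (R := R) (X := σ)).toLinearMap

/-- `[w]f` read in the monoid algebra. [cite: HrubesWigdersonYehudayoff2010, §2] -/
theorem coeff_apply (w : List σ) (f : FreeAlgebra R σ) :
    coeff w f = (FreeAlgebra.equivMonoidAlgebraFreeMonoid f).coeff (FreeMonoid.ofList w) := rfl

/-- Words are the basis: `[w]u = [u = w]`. [cite: HrubesWigdersonYehudayoff2010, §2] -/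
theorem coeff_word [DecidableEq σ] (w u : List σ) :
    coeff w ((u.map (FreeAlgebra.ι R)).prod) = if u = w then (1 : R) else 0 := by
  have h := equiv_symm_single (σ := σ) (1 : R) u; rw [one_smul] at h
  rw [coeff_apply, ← h, AlgEquiv.apply_symm_apply, MonoidAlgebra.coeff_single]
  by_cases huw : u = w
  · rw [if_pos huw, huw, Finsupp.single_eq_same]
  · rw [if_neg huw, Finsupp.single_eq_of_ne]
    exact fun h' => huw (FreeMonoid.ofList.injective h').symm

/-- The degree-`e` component (`e ≤ d`) of a word is the word or `0`, by length. [cite: HrubesWigdersonYehudayoff2010, §A] -/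
theorem degPart_word {d e : ℕ} (he : e ≤ d) (u : List σ) :
    degPart (R := R) d e ((u.map (FreeAlgebra.ι R)).prod) =
      if u.length = e then (u.map (FreeAlgebra.ι R)).prod else 0 := by
  simp only [degPart, dfaProj_word, wordDfa_cnt, Nat.zero_add]
  split_ifs <;> first | rfl | (exfalso; omega)

/-- **Splitting a coefficient along the cut** (the computation behind Prop. 2.1): for a word `w` of
length `a + b ≤ d`, `[w](p_a q_b) = [w|_{<a}] p_a · [w|_{≥a}] q_b`. [cite: HrubesWigdersonYehudayoff2010, Prop. 2.1] -/
theorem coeff_mul_degPart [DecidableEq σ] {d a b : ℕ} (hab : a + b ≤ d) (w : List σ)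
    (hw : w.length = a + b) (p q : FreeAlgebra R σ) :
    coeff w (degPart d a p * degPart d b q) =
      coeff (w.take a) (degPart d a p) * coeff (w.drop a) (degPart d b q) := by
  induction p using word_induction with
  | h0 => simp only [map_zero, zero_mul]
  | hadd f g hf hg => simp only [map_add, add_mul, hf, hg]
  | hw r u =>
    induction q using word_induction with
    | h0 => simp only [map_zero, mul_zero]
    | hadd f g hf hg => simp only [map_add, mul_add, hf, hg]
    | hw r' v =>
      rw [map_smul, map_smul, degPart_word (by omega) u, degPart_word (by omega) v]
      by_cases hu : u.length = a
      · by_cases hv : v.length = b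
        · rw [if_pos hu, if_pos hv, smul_mul_smul_comm, ← List.prod_append, ← List.map_append,
            map_smul, map_smul, map_smul, coeff_word, coeff_word, coeff_word, smul_eq_mul,
            smul_eq_mul, smul_eq_mul]
          by_cases huv : u ++ v = w
          · subst huv; rw [List.take_left' hu, List.drop_left' hu, if_pos rfl, if_pos rfl, if_pos rfl]; ring
          · rw [if_neg huv]
            by_cases hz : u = w.take a
            · have hz' : v ≠ w.drop a := fun hv' => huv (by rw [hz, hv', List.take_append_drop])
              rw [if_neg hz']; ring
            · rw [if_neg hz]; ring
        · simp only [if_pos hu, if_neg hv, smul_zero, mul_zero, map_zero]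
      · simp only [if_neg hu, smul_zero, zero_mul, map_zero]

/-- The cut on split words: `[u v](p q) = [u]p · [v]q` for `p`, `q` homogeneous of degrees `|u|`, `|v|`
(`|u| + |v| ≤ 4`). [cite: HrubesWigdersonYehudayoff2010, Prop. 2.1] -/
theorem coeff_cut [DecidableEq σ] {a b : ℕ} (hab : a + b ≤ 4) (u v : List σ) (hu : u.length = a)
    (hv : v.length = b) {p q : FreeAlgebra R σ} (hp : degPart 4 a p = p) (hq : degPart 4 b q = q) :
    coeff (u ++ v) (p * q) = coeff u p * coeff v q := by
  have := coeff_mul_degPart hab (u ++ v) (by rw [List.length_append, hu, hv]) p q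
  rwa [hp, hq, List.take_left' hu, List.drop_left' hu] at this

/-- Body FIRST (`r = 0`): `[x₁x₂x₃x₄](h g h̄) = [∅]h · [x₁x₂]g · [x₃x₄]h̄`. [cite: HrubesWigdersonYehudayoff2010, Prop. B.1 (i)] -/
theorem coeff_hghb₀ [DecidableEq σ] {h g hb : FreeAlgebra R σ} (hh : degPart 4 0 h = h)
    (hg : degPart 4 2 g = g) (hhb : degPart 4 2 hb = hb) (x₁ x₂ x₃ x₄ : σ) :
    coeff [x₁, x₂, x₃, x₄] (h * g * hb) = coeff [] h * coeff [x₁, x₂] g * coeff [x₃, x₄] hb := by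
  have hhg : degPart 4 2 (h * g) = h * g := by simpa using degPart_mul_of_eq hh hg (by norm_num)
  exact (coeff_cut (a := 2) (b := 2) (by norm_num) [x₁, x₂] [x₃, x₄] rfl rfl hhg hhb).trans
    (congrArg (· * coeff [x₃, x₄] hb) (coeff_cut (a := 0) (b := 2) (by norm_num) [] [x₁, x₂] rfl rfl hh hg))

/-- Body in the MIDDLE (`r = 1`): `[x₁x₂x₃x₄](h g h̄) = [x₁]h · [x₂x₃]g · [x₄]h̄`. [cite: HrubesWigdersonYehudayoff2010, Prop. B.1 (i)] -/
theorem coeff_hghb₁ [DecidableEq σ] {h g hb : FreeAlgebra R σ} (hh : degPart 4 1 h = h)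
    (hg : degPart 4 2 g = g) (hhb : degPart 4 1 hb = hb) (x₁ x₂ x₃ x₄ : σ) :
    coeff [x₁, x₂, x₃, x₄] (h * g * hb) = coeff [x₁] h * coeff [x₂, x₃] g * coeff [x₄] hb := by
  have hhg : degPart 4 3 (h * g) = h * g := by simpa using degPart_mul_of_eq hh hg (by norm_num)
  exact (coeff_cut (a := 3) (b := 1) (by norm_num) [x₁, x₂, x₃] [x₄] rfl rfl hhg hhb).trans
    (congrArg (· * coeff [x₄] hb) (coeff_cut (a := 1) (b := 2) (by norm_num) [x₁] [x₂, x₃] rfl rfl hh hg))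

/-- Body LAST (`r = 2`): `[x₁x₂x₃x₄](h g h̄) = [x₁x₂]h · [x₃x₄]g · [∅]h̄`. [cite: HrubesWigdersonYehudayoff2010, Prop. B.1 (i)] -/
theorem coeff_hghb₂ [DecidableEq σ] {h g hb : FreeAlgebra R σ} (hh : degPart 4 2 h = h)
    (hg : degPart 4 2 g = g) (hhb : degPart 4 0 hb = hb) (x₁ x₂ x₃ x₄ : σ) :
    coeff [x₁, x₂, x₃, x₄] (h * g * hb) = coeff [x₁, x₂] h * coeff [x₃, x₄] g * coeff [] hb := by
  have hhg : degPart 4 4 (h * g) = h * g := by simpa using degPart_mul_of_eq hh hg (by norm_num)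
  exact (coeff_cut (a := 4) (b := 0) (by norm_num) [x₁, x₂, x₃, x₄] [] rfl rfl hhg hhb).trans
    (congrArg (· * coeff [] hb) (coeff_cut (a := 2) (b := 2) (by norm_num) [x₁, x₂] [x₃, x₄] rfl rfl hh hg))

end Coeff

/-! ## §2 The degree-four family `ID_k`, its commutative image `SOS_k`, the `XYXY` functional -/
section Four
variable (F : Type u) [CommRing F]

/-- HWY's degree-four polynomial `ID_k = Σ_{i,j∈[k]} x_i y_j x_i y_j` (`x = inl`, `y = inr`), as a
sum of words. [cite: HrubesWigdersonYehudayoff2010, §1.3] -/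
def idPoly (k : ℕ) : FreeAlgebra F (Fin k ⊕ Fin k) :=
  ∑ i : Fin k, ∑ j : Fin k,
    (([Sum.inl i, Sum.inr j, Sum.inl i, Sum.inr j] : List (Fin k ⊕ Fin k)).map (FreeAlgebra.ι F)).prod

/-- **D1.** `ID_k^{(c)} = SOS_k`. [cite: HrubesWigdersonYehudayoff2010, §1.3] -/
theorem commImage_idPoly (k : ℕ) : commImage (idPoly F k) = HWY10.sosPoly F k := by
  simp only [idPoly, map_sum, List.map_cons, List.map_nil, List.prod_cons, List.prod_nil, mul_one,
    map_mul, commImage_ι, HWY10.sosPoly, Finset.sum_mul_sum]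
  exact Finset.sum_congr rfl fun i _ => Finset.sum_congr rfl fun j _ => by ring

/-- `ID_k` is homogeneous of degree four. [cite: HrubesWigdersonYehudayoff2010, §1.3] -/
theorem degPart_idPoly (k : ℕ) : degPart 4 4 (idPoly F k) = idPoly F k := by
  simp only [idPoly, map_sum]
  refine Finset.sum_congr rfl fun i _ => Finset.sum_congr rfl fun j _ => ?_
  rw [degPart_word (le_refl 4)]; exact if_pos rfl

/-- The `XYXY`-coefficients of `ID_k`: `[x_i y_j x_{i'} y_{j'}] ID_k = [i = i' ∧ j = j']`. [cite: HrubesWigdersonYehudayoff2010, §1.3] -/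
theorem coeff_idPoly {k : ℕ} (i j i' j' : Fin k) :
    coeff [Sum.inl i, Sum.inr j, Sum.inl i', Sum.inr j'] (idPoly F k) =
      if i = i' ∧ j = j' then (1 : F) else 0 := by
  simp only [idPoly, map_sum, coeff_word, List.cons.injEq, Sum.inl.injEq, Sum.inr.injEq, and_true]
  rw [Finset.sum_eq_single i, Finset.sum_eq_single j]
  · by_cases h : i = i' ∧ j = j' <;> simp [h]
  · exact fun b _ hb => if_neg fun h => hb h.2.1
  · exact fun h => absurd (Finset.mem_univ _) h
  · exact fun a _ ha => Finset.sum_eq_zero fun b _ => if_neg fun h => ha h.1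
  · exact fun h => absurd (Finset.mem_univ _) h

/-- Products of two bilinear forms, expanded over the `X,Y,X,Y` indices. [cite: HrubesWigdersonYehudayoff2010, §1.3] -/
theorem bilinForm_mul_bilinForm {k : ℕ} (a b : Fin k → Fin k → F) :
    HWY10.bilinForm F a * HWY10.bilinForm F b = ∑ i : Fin k, ∑ j : Fin k, ∑ i' : Fin k, ∑ j' : Fin k,
      (a i j * b i' j') • (X (Sum.inl i) * X (Sum.inr j) * (X (Sum.inl i') * X (Sum.inr j')) :
        MvPolynomial (Fin k ⊕ Fin k) F) := by
  simp only [HWY10.bilinForm, Finset.sum_mul]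
  simp only [Finset.mul_sum, smul_mul_smul_comm]

/-- Bilinear forms are additive in the coefficient matrix. [cite: HrubesWigdersonYehudayoff2010, §1.3] -/
theorem bilinForm_add {k : ℕ} (a b : Fin k → Fin k → F) :
    HWY10.bilinForm F (a + b) = HWY10.bilinForm F a + HWY10.bilinForm F b := by
  simp only [HWY10.bilinForm, Pi.add_apply, add_smul, Finset.sum_add_distrib]

/-- Bilinear forms are homogeneous in the coefficient matrix. [cite: HrubesWigdersonYehudayoff2010, §1.3] -/
theorem bilinForm_smul {k : ℕ} (c : F) (a : Fin k → Fin k → F) :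
    HWY10.bilinForm F (c • a) = c • HWY10.bilinForm F a := by
  simp only [HWY10.bilinForm, Pi.smul_apply, smul_eq_mul, mul_smul, Finset.smul_sum]

/-- The zero matrix gives the zero form. [cite: HrubesWigdersonYehudayoff2010, §1.3] -/
theorem bilinForm_zero {k : ℕ} : HWY10.bilinForm F (0 : Fin k → Fin k → F) = 0 := by
  simp only [HWY10.bilinForm, Pi.zero_apply, zero_smul, Finset.sum_const_zero]

/-- Exchanging the second and fourth summation of a fourfold sum. [cite: HrubesWigdersonYehudayoff2010, Prop. B.1] -/
theorem sum4_swap24 {M : Type*} [AddCommMonoid M] {k : ℕ} (T : Fin k → Fin k → Fin k → Fin k → M) :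
    (∑ i, ∑ j, ∑ i', ∑ j', T i j i' j') = ∑ i, ∑ j, ∑ i', ∑ j', T i j' i' j := by
  refine Finset.sum_congr rfl fun i _ => ?_
  calc (∑ j, ∑ i', ∑ j', T i j i' j') = ∑ j, ∑ j', ∑ i', T i j i' j' := Finset.sum_congr rfl fun j _ => Finset.sum_comm
    _ = ∑ j', ∑ j, ∑ i', T i j i' j' := Finset.sum_comm
    _ = ∑ j', ∑ i', ∑ j, T i j i' j' := Finset.sum_congr rfl fun j' _ => Finset.sum_comm

/-- The ordered `XYXY`-COEFFICIENT functional `f ↦ Σ [x_i y_j x_{i'} y_{j'}]f · x_i y_j x_{i'} y_{j'}`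
(HWY's `f ↦ f^{(c)}` on the ordered degree-four part). [cite: HrubesWigdersonYehudayoff2010, Prop. 2.1] -/
def quadXY (k : ℕ) : FreeAlgebra F (Fin k ⊕ Fin k) →ₗ[F] MvPolynomial (Fin k ⊕ Fin k) F :=
  ∑ i : Fin k, ∑ j : Fin k, ∑ i' : Fin k, ∑ j' : Fin k,
    (coeff [Sum.inl i, Sum.inr j, Sum.inl i', Sum.inr j']).smulRight
      (X (Sum.inl i) * X (Sum.inr j) * (X (Sum.inl i') * X (Sum.inr j')))

/-- `quadXY` unfolded. [cite: HrubesWigdersonYehudayoff2010, Prop. 2.1] -/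
theorem quadXY_apply {k : ℕ} (f : FreeAlgebra F (Fin k ⊕ Fin k)) :
    quadXY F k f = ∑ i : Fin k, ∑ j : Fin k, ∑ i' : Fin k, ∑ j' : Fin k,
      coeff [Sum.inl i, Sum.inr j, Sum.inl i', Sum.inr j'] f •
        (X (Sum.inl i) * X (Sum.inr j) * (X (Sum.inl i') * X (Sum.inr j'))) := by
  simp only [quadXY, LinearMap.sum_apply, LinearMap.smulRight_apply]

/-- `quadXY ID_k = SOS_k`. [cite: HrubesWigdersonYehudayoff2010, §1.3] -/
theorem quadXY_idPoly (k : ℕ) : quadXY F k (idPoly F k) = HWY10.sosPoly F k := by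
  rw [quadXY_apply]; simp only [coeff_idPoly]
  have inner : ∀ i j : Fin k, (∑ i' : Fin k, ∑ j' : Fin k,
      (if i = i' ∧ j = j' then (1 : F) else 0) • (X (Sum.inl i) * X (Sum.inr j) *
        (X (Sum.inl i') * X (Sum.inr j')) : MvPolynomial (Fin k ⊕ Fin k) F)) =
      X (Sum.inl i) * X (Sum.inr j) * (X (Sum.inl i) * X (Sum.inr j)) := by
    intro i j; rw [Finset.sum_eq_single i, Finset.sum_eq_single j]
    · rw [if_pos ⟨rfl, rfl⟩, one_smul]
    · exact fun j' _ hj' => by rw [if_neg fun h => hj' h.2.symm, zero_smul]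
    · exact fun h => absurd (Finset.mem_univ _) h
    · exact fun i' _ hi' => Finset.sum_eq_zero fun j' _ => by rw [if_neg fun h => hi' h.1.symm, zero_smul]
    · exact fun h => absurd (Finset.mem_univ _) h
  simp only [inner, HWY10.sosPoly, Finset.sum_mul_sum]
  exact Finset.sum_congr rfl fun i _ => Finset.sum_congr rfl fun j _ => by ring

/-! ## §3 Proposition B.1(i) / 2.1 in span form: central products under `quadXY` -/
/-- A product of two bilinear forms from its `XYXY`-coefficients, straight. [cite: HrubesWigdersonYehudayoff2010, Prop. B.1 (i)] -/
theorem quadXY_eq_mul {k : ℕ} {f : FreeAlgebra F (Fin k ⊕ Fin k)} {a b : Fin k → Fin k → F}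
    (hc : ∀ i j i' j', coeff [Sum.inl i, Sum.inr j, Sum.inl i', Sum.inr j'] f = a i j * b i' j') :
    quadXY F k f = HWY10.bilinForm F a * HWY10.bilinForm F b := by
  rw [quadXY_apply, bilinForm_mul_bilinForm]
  exact Finset.sum_congr rfl fun i _ => Finset.sum_congr rfl fun j _ =>
    Finset.sum_congr rfl fun i' _ => Finset.sum_congr rfl fun j' _ => by rw [hc]

/-- A product of two bilinear forms from its `XYXY`-coefficients, TWISTED in `y_j ↔ y_{j'}` (the variables
commute in the target). [cite: HrubesWigdersonYehudayoff2010, Prop. B.1 (i)] -/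
theorem quadXY_eq_mul_twist {k : ℕ} {f : FreeAlgebra F (Fin k ⊕ Fin k)} {a b : Fin k → Fin k → F}
    (hc : ∀ i j i' j', coeff [Sum.inl i, Sum.inr j, Sum.inl i', Sum.inr j'] f = a i j' * b i' j) :
    quadXY F k f = HWY10.bilinForm F a * HWY10.bilinForm F b := by
  rw [quadXY_apply, bilinForm_mul_bilinForm, sum4_swap24]
  refine Finset.sum_congr rfl fun i _ => Finset.sum_congr rfl fun j _ =>
    Finset.sum_congr rfl fun i' _ => Finset.sum_congr rfl fun j' _ => ?_
  rw [hc]; simp only [MvPolynomial.smul_eq_C_mul, map_mul]; ring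

/-- Body FIRST: `quadXY (h g h̄) = g[X,Y] · ([∅]h · h̄[X,Y])`. [cite: HrubesWigdersonYehudayoff2010, Prop. B.1 (i)] -/
theorem quadXY_hghb₀ {k : ℕ} {h g hb : FreeAlgebra F (Fin k ⊕ Fin k)} (hh : degPart 4 0 h = h)
    (hg : degPart 4 2 g = g) (hhb : degPart 4 2 hb = hb) :
    quadXY F k (h * g * hb) = HWY10.bilinForm F (fun i j => coeff [Sum.inl i, Sum.inr j] g) *
      HWY10.bilinForm F (fun i j => coeff [] h * coeff [Sum.inl i, Sum.inr j] hb) :=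
  quadXY_eq_mul F fun i j i' j' => by rw [coeff_hghb₀ hh hg hhb]; ring

/-- Body in the MIDDLE: `quadXY (h g h̄) = g[Y,X] · (h[X] ⊗ h̄[Y])` (the twisted form of the body).
[cite: HrubesWigdersonYehudayoff2010, Prop. B.1 (i)] -/
theorem quadXY_hghb₁ {k : ℕ} {h g hb : FreeAlgebra F (Fin k ⊕ Fin k)} (hh : degPart 4 1 h = h)
    (hg : degPart 4 2 g = g) (hhb : degPart 4 1 hb = hb) :
    quadXY F k (h * g * hb) = HWY10.bilinForm F (fun i j => coeff [Sum.inr j, Sum.inl i] g) *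
      HWY10.bilinForm F (fun i j => coeff [Sum.inl i] h * coeff [Sum.inr j] hb) :=
  (quadXY_eq_mul_twist F fun i j i' j' => by rw [coeff_hghb₁ hh hg hhb]; ring).trans (mul_comm _ _)

/-- Body LAST: `quadXY (h g h̄) = g[X,Y] · (h[X,Y] · [∅]h̄)`. [cite: HrubesWigdersonYehudayoff2010, Prop. B.1 (i)] -/
theorem quadXY_hghb₂ {k : ℕ} {h g hb : FreeAlgebra F (Fin k ⊕ Fin k)} (hh : degPart 4 2 h = h)
    (hg : degPart 4 2 g = g) (hhb : degPart 4 0 hb = hb) :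
    quadXY F k (h * g * hb) = HWY10.bilinForm F (fun i j => coeff [Sum.inl i, Sum.inr j] g) *
      HWY10.bilinForm F (fun i j => coeff [Sum.inl i, Sum.inr j] h * coeff [] hb) :=
  (quadXY_eq_mul F fun i j i' j' => by rw [coeff_hghb₂ hh hg hhb]; ring).trans (mul_comm _ _)

/-- TWO FORMS PER BODY: `Σ_{g ∈ T} (g[X,Y]·H₀(g) + g[Y,X]·H₁(g))`. [cite: HrubesWigdersonYehudayoff2010, Prop. B.1] -/
def cenBil {k : ℕ} (T : Finset (FreeAlgebra F (Fin k ⊕ Fin k))) (H₀ H₁ : ↥T → Fin k → Fin k → F) :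
    MvPolynomial (Fin k ⊕ Fin k) F :=
  ∑ g : ↥T, (HWY10.bilinForm F (fun i j => coeff [Sum.inl i, Sum.inr j] g.1) *
      HWY10.bilinForm F (H₀ g) +
    HWY10.bilinForm F (fun i j => coeff [Sum.inr j, Sum.inl i] g.1) * HWY10.bilinForm F (H₁ g))

/-- `cenBil` is additive in `(H₀, H₁)`. [cite: HrubesWigdersonYehudayoff2010, Prop. B.1] -/
theorem cenBil_add {k : ℕ} (T : Finset (FreeAlgebra F (Fin k ⊕ Fin k)))
    (H₀ H₀' H₁ H₁' : ↥T → Fin k → Fin k → F) :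
    cenBil F T (H₀ + H₀') (H₁ + H₁') = cenBil F T H₀ H₁ + cenBil F T H₀' H₁' := by
  simp only [cenBil, Pi.add_apply, bilinForm_add, mul_add, Finset.sum_add_distrib]
  abel

/-- `cenBil` is homogeneous in `(H₀, H₁)`. [cite: HrubesWigdersonYehudayoff2010, Prop. B.1] -/
theorem cenBil_smul {k : ℕ} (T : Finset (FreeAlgebra F (Fin k ⊕ Fin k))) (c : F)
    (H₀ H₁ : ↥T → Fin k → Fin k → F) :
    cenBil F T (c • H₀) (c • H₁) = c • cenBil F T H₀ H₁ := by
  simp only [cenBil, Pi.smul_apply, bilinForm_smul, mul_smul_comm, Finset.smul_sum, smul_add]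

/-- One body. [cite: HrubesWigdersonYehudayoff2010, Prop. B.1] -/
theorem cenBil_single {k : ℕ} (T : Finset (FreeAlgebra F (Fin k ⊕ Fin k))) (g₀ : ↥T)
    (H₀ H₁ : ↥T → Fin k → Fin k → F) (h0 : ∀ g, g ≠ g₀ → H₀ g = 0) (h1 : ∀ g, g ≠ g₀ → H₁ g = 0) :
    cenBil F T H₀ H₁ = HWY10.bilinForm F (fun i j => coeff [Sum.inl i, Sum.inr j] g₀.1) *
        HWY10.bilinForm F (H₀ g₀) +
      HWY10.bilinForm F (fun i j => coeff [Sum.inr j, Sum.inl i] g₀.1) * HWY10.bilinForm F (H₁ g₀) := by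
  rw [cenBil, Finset.sum_eq_single g₀]
  · intro g _ hg
    simp only [h0 g hg, h1 g hg, bilinForm_zero, mul_zero, add_zero]
  · exact fun h => absurd (Finset.mem_univ _) h

/-- **Proposition B.1(i), span form.** If the degree-two bodies lie in a finite set `T` of quadratics,
the degree-four central span maps under `quadXY` into `cenBil T`. [cite: HrubesWigdersonYehudayoff2010, Prop. B.1 (i)] -/
theorem quadXY_mem_cenBil {k : ℕ} (T : Finset (FreeAlgebra F (Fin k ⊕ Fin k)))
    (hT : ∀ g ∈ T, degPart 4 2 g = g) {B : ℕ → Set (FreeAlgebra F (Fin k ⊕ Fin k))} (hB : B 2 ⊆ ↑T)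
    {f : FreeAlgebra F (Fin k ⊕ Fin k)} (hf : f ∈ cenSpan B 4 4) :
    ∃ H₀ H₁ : ↥T → Fin k → Fin k → F, quadXY F k f = cenBil F T H₀ H₁ := by
  classical
  rw [cenSpan] at hf; induction hf using Submodule.span_induction with
  | mem x hx =>
    obtain ⟨e, r, g, h, hb, hg, h1, h2, her, hh, hhb, rfl⟩ := hx
    obtain rfl : e = 2 := by omega
    have hgT : g ∈ T := hB hg; have hg2 : degPart 4 2 g = g := hT g hgT
    rcases (by omega : r = 0 ∨ r = 1 ∨ r = 2) with rfl | rfl | rfl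
    · refine ⟨fun g' => if g' = ⟨g, hgT⟩ then (fun i j => coeff [] h * coeff [Sum.inl i, Sum.inr j] hb)
        else 0, 0, ?_⟩
      rw [cenBil_single F T ⟨g, hgT⟩, if_pos rfl, Pi.zero_apply, bilinForm_zero, mul_zero, add_zero]
      exacts [quadXY_hghb₀ F hh hg2 (by simpa using hhb), fun g' hg' => if_neg hg', fun _ _ => rfl]
    · refine ⟨0, fun g' => if g' = ⟨g, hgT⟩ then (fun i j => coeff [Sum.inl i] h * coeff [Sum.inr j] hb)
        else 0, ?_⟩
      rw [cenBil_single F T ⟨g, hgT⟩, if_pos rfl, Pi.zero_apply, bilinForm_zero, mul_zero, zero_add]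
      exacts [quadXY_hghb₁ F hh hg2 (by simpa using hhb), fun _ _ => rfl, fun g' hg' => if_neg hg']
    · refine ⟨fun g' => if g' = ⟨g, hgT⟩ then (fun i j => coeff [Sum.inl i, Sum.inr j] h * coeff [] hb)
        else 0, 0, ?_⟩
      rw [cenBil_single F T ⟨g, hgT⟩, if_pos rfl, Pi.zero_apply, bilinForm_zero, mul_zero, add_zero]
      exacts [quadXY_hghb₂ F hh hg2 (by simpa using hhb), fun g' hg' => if_neg hg', fun _ _ => rfl]
  | zero => exact ⟨0, 0, by simp only [map_zero, cenBil, Pi.zero_apply, bilinForm_zero, mul_zero,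
      add_zero, Finset.sum_const_zero]⟩
  | add x y _ _ hx hy =>
    obtain ⟨H₀, H₁, hx⟩ := hx
    obtain ⟨H₀', H₁', hy⟩ := hy
    exact ⟨H₀ + H₀', H₁ + H₁', by rw [map_add, hx, hy, cenBil_add]⟩
  | smul c x _ hx =>
    obtain ⟨H₀, H₁, hx⟩ := hx
    exact ⟨c • H₀, c • H₁, by rw [map_smul, hx, cenBil_smul]⟩

/-- `cenBil T` has bilinear complexity `≤ 2·|T|`. [cite: HrubesWigdersonYehudayoff2010, Prop. 2.1] -/
theorem bilinearComplexity_cenBil_le {k : ℕ} (T : Finset (FreeAlgebra F (Fin k ⊕ Fin k)))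
    (H₀ H₁ : ↥T → Fin k → Fin k → F) :
    HWY10.bilinearComplexity F (cenBil F T H₀ H₁) ≤ 2 * T.card := by
  have hc : Fintype.card (↥T × Fin 2) = 2 * T.card := by
    rw [Fintype.card_prod, Fintype.card_coe, Fintype.card_fin, mul_comm]
  obtain ⟨PA, hPA0, hPA1⟩ : ∃ PA : ↥T × Fin 2 → Fin k → Fin k → F,
      (∀ g, PA (g, 0) = fun i j => coeff [Sum.inl i, Sum.inr j] g.1) ∧
        ∀ g, PA (g, 1) = fun i j => coeff [Sum.inr j, Sum.inl i] g.1 :=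
    ⟨fun q => (![fun i j => coeff [Sum.inl i, Sum.inr j] q.1.1, fun i j => coeff [Sum.inr j, Sum.inl i] q.1.1] :
      Fin 2 → Fin k → Fin k → F) q.2, fun g => by simp, fun g => by simp⟩
  obtain ⟨PB, hPB0, hPB1⟩ : ∃ PB : ↥T × Fin 2 → Fin k → Fin k → F,
      (∀ g, PB (g, 0) = H₀ g) ∧ ∀ g, PB (g, 1) = H₁ g :=
    ⟨fun q => (![H₀ q.1, H₁ q.1] : Fin 2 → Fin k → Fin k → F) q.2, fun g => by simp, fun g => by simp⟩
  rw [HWY10.bilinearComplexity]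
  refine Nat.sInf_le ⟨fun l => PA ((Fintype.equivFinOfCardEq hc).symm l),
    fun l => PB ((Fintype.equivFinOfCardEq hc).symm l), ?_⟩
  rw [(Fintype.equivFinOfCardEq hc).symm.sum_comp
      (fun q => HWY10.bilinForm F (PA q) * HWY10.bilinForm F (PB q)), Fintype.sum_prod_type, cenBil]
  exact Finset.sum_congr rfl fun g _ => by simp only [Fin.sum_univ_two, hPA0, hPA1, hPB0, hPB1]

/-- **D2 (Prop. 2.1 with B.1, span form; "w(ID_k) ≥ B(SOS_k)/2").** If `ID_k` lies in the degree-four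
central span over `t` quadratic bodies, then `B_F(SOS_k) ≤ 2t`. [cite: HrubesWigdersonYehudayoff2010, Prop. 2.1] -/
theorem sos_bilinear_le_two_card {k : ℕ} (T : Finset (FreeAlgebra F (Fin k ⊕ Fin k)))
    (hT : ∀ g ∈ T, degPart 4 2 g = g) {B : ℕ → Set (FreeAlgebra F (Fin k ⊕ Fin k))} (hB : B 2 ⊆ ↑T)
    (h : idPoly F k ∈ cenSpan B 4 4) : HWY10.bilinearComplexity F (HWY10.sosPoly F k) ≤ 2 * T.card := by
  obtain ⟨H₀, H₁, hq⟩ := quadXY_mem_cenBil F T hT hB h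
  rw [← quadXY_idPoly F k, hq]
  exact bilinearComplexity_cenBil_le F T H₀ H₁

/-! ## §4 Theorem 1.6 at degree four and the conditional rung -/
/-- **D3 (Thm 1.6 at degree four, constant 2).** A fan-in-two noncommutative circuit with `≤ s` gates
computing `ID_k` gives `B_F(SOS_k) ≤ 2s` (every commutative ring). [cite: HrubesWigdersonYehudayoff2010, Thm 1.6] -/
theorem sos_bilinear_le_two_size {k s : ℕ} (h : HasNcCircuitSizeLE (idPoly F k) s) :
    HWY10.bilinearComplexity F (HWY10.sosPoly F k) ≤ 2 * s := by
  classical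
  obtain ⟨vals, hlen, hmem⟩ := central_structure_of_size (le_refl 4) (degPart_idPoly F k) h
  have hT : ∀ g ∈ (vals.map (degPart (R := F) 4 2)).toFinset, degPart 4 2 g = g := fun g hg => by
    obtain ⟨p, -, rfl⟩ := List.mem_map.1 (List.mem_toFinset.1 hg); exact degPart_idem 4 2 p
  have hB : bodies vals 4 2 ⊆ ↑(vals.map (degPart (R := F) 4 2)).toFinset := by
    rintro g ⟨p, hp, rfl⟩
    exact List.mem_toFinset.2 (List.mem_map.2 ⟨p, hp, rfl⟩)
  refine (sos_bilinear_le_two_card F _ hT hB hmem).trans ?_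
  have : (vals.map (degPart (R := F) 4 2)).toFinset.card ≤ vals.length :=
    (List.toFinset_card_le _).trans (le_of_eq (List.length_map ..))
  omega

/-- **D4 (the degree-four rung, conditional).** If `B_F(SOS_k) ≥ c·k^{1+ε}` (`SOSBilinearSuperlinear F`,
OPEN), then every fan-in-two noncommutative circuit for `ID_k` has `≥ (c/2)·k^{1+ε}` gates.
[cite: HrubesWigdersonYehudayoff2010, Thm 1.6 with §1.3] -/
theorem idPoly_hard_of_sos (hS : HWY10.SOSBilinearSuperlinear F) :
    ∃ ε : ℝ, 0 < ε ∧ ∃ c : ℝ, 0 < c ∧ ∀ k s : ℕ, HasNcCircuitSizeLE (idPoly F k) s →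
      c * (k : ℝ) ^ (1 + ε) ≤ (s : ℝ) := by
  obtain ⟨ε, hε, c, hc, hB⟩ := hS
  refine ⟨ε, hε, c / 2, by positivity, fun k s hs => ?_⟩
  have h2 : (HWY10.bilinearComplexity F (HWY10.sosPoly F k) : ℝ) ≤ 2 * (s : ℝ) := by
    exact_mod_cast sos_bilinear_le_two_size F hs
  rw [show c / 2 * (k : ℝ) ^ (1 + ε) = c * (k : ℝ) ^ (1 + ε) / 2 by ring]
  linarith [hB k]

end Four

end Summit.ValiantsHypothesis.ValiantsHypothesis.Theorems.NcSOSDegreeFour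

end
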